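import Summits.HubbardSuperconductivity.HubbardSuperconductivity.Theses.ChiralWindow
import Summits.HubbardSuperconductivity.HubbardSuperconductivity.Theorems.CwSsbToEvenTorusLRO.Negative.BlockStubEncodingConverse
import Summits.HubbardSuperconductivity.HubbardSuperconductivity.Theorems.WcbcsSsbToTorusLRO.Negative.BlockRepulsionDominatesPairOrder
import Summits.HubbardSuperconductivity.HubbardSuperconductivity.Theorems.BalabanIRBirEveryGroundStateSchur
import Literature.MathematicalPhysics.QuantumLattice.FinDimSpectrumProofs
import Literature.MathematicalPhysics.QuantumLattice.DWaveSourceProofs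
import Literature.MathematicalPhysics.QuantumLattice.GroundStateSourceBounds
import Literature.MathematicalPhysics.QuantumLattice.HubbardModelParticleHoleProofs
import Literature.MathematicalPhysics.QuantumLattice.SectorSpectrum
import Literature.MathematicalPhysics.QuantumLattice.BdGBondHamiltonianTorus

/-!
# drefute (refuter-drefute-stmt-HubbardSuperconductivity-10439-0): candidate PROOFS of the finite-`L` stubs of line
`griffiths-block-slope` (crux `CwSsbToEvenTorusLRO`, stmt-HubbardSuperconductivity-10439)

Statements verbatim from `Cruxes/CwSsbToEvenTorusLRO/Lines/griffiths-block-slope.lean` (lead v1):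
`stub_sectorFloorGC` (S5), `stub_sourceRemoval` (S4), `stub_blockSlope` (S1). Evidence for the lead (a prover lands them);
not a refutation. All folklore linear algebra over the tree's `FinDimSpectrumProofs` / `GroundStateSourceBounds` API.
-/

noncomputable section

set_option linter.dupNamespace false

namespace Summit.HubbardSuperconductivity.HubbardSuperconductivity.Cruxes.CwSsbToEvenTorusLRO.DrefuteStubProofs

open Literature.MathematicalPhysics.QuantumLattice Matrix
open Summit.HubbardSuperconductivity.HubbardSuperconductivity.Theorems.CwSsbToEvenTorusLRO.Negative
  (isHermitian_kacBlockOp isHermitian_add_real_smul)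
open Summit.HubbardSuperconductivity.WcbcsSsbToTorusLRO.Negative
  (sum_blockPair re_expect_pairIntensity_le_sq_mul_blockRepulsion)
open Summit.HubbardSuperconductivity.HubbardSuperconductivity.Theorems (bddBelow_rayleighSet)
open scoped Matrix ComplexOrder Matrix.Norms.L2Operator BigOperators

/-! ## S5: the sector energy dominates the grand-canonical one -/

section Abstract

variable {Λ : Type*} [Fintype Λ] [DecidableEq Λ] [LinearOrder Λ]

/-- Abstract S5: for `A = H - μN̂ + X` Hermitian and a non-empty sector `(N, M)`,
`E₀(H - μN̂ + X) ≤ minEnergyOn (H + X) (szSector N M) - μN` (unit sector vectors are trial vectors, `N̂ = N` there). -/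
theorem groundEnergy_le_minEnergyOn_sector_sub (H X : Matrix (Finset (Orb Λ)) (Finset (Orb Λ)) ℂ) (μ : ℝ) (N : ℕ)
    (M : ℝ) (hA : (H - (μ : ℂ) • totalNumber + X).IsHermitian)
    (hne : ∃ φ : Fock (Orb Λ), φ ∈ szSector N M ∧ φ ≠ 0) :
    (H - (μ : ℂ) • totalNumber + X).groundEnergy ≤ (H + X).minEnergyOn (szSector N M) - μ * (N : ℝ) := by
  obtain ⟨φ, hφS, hφ0⟩ := hne
  obtain ⟨c, -, hc1⟩ := exists_smul_unit hφ0
  have hcφS : c • φ ∈ szSector N M := Submodule.smul_mem _ c hφS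
  rw [le_sub_iff_add_le]
  refine le_csInf ⟨_, c • φ, hcφS, hc1, rfl⟩ ?_
  rintro E ⟨ψ, hψS, hψ1, rfl⟩
  have hN : (totalNumber : Matrix (Finset (Orb Λ)) (Finset (Orb Λ)) ℂ) *ᵥ ψ = (N : ℂ) • ψ :=
    totalNumber_mulVec_of_isNParticle ((mem_szSector_iff N M ψ).1 hψS).1
  have h := groundEnergy_le_rayleigh_holds hA ψ hψ1
  have e : star ψ ⬝ᵥ (H - (μ : ℂ) • totalNumber + X) *ᵥ ψ =
      star ψ ⬝ᵥ (H + X) *ᵥ ψ - ((μ * (N : ℝ) : ℝ) : ℂ) := by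
    rw [add_mulVec, sub_mulVec, smul_mulVec, hN, smul_smul, add_mulVec, dotProduct_add, dotProduct_sub,
      dotProduct_add, dotProduct_smul, hψ1, smul_eq_mul, mul_one]
    push_cast
    ring
  rw [e, Complex.sub_re, Complex.ofReal_re] at h
  linarith

end Abstract

/-- **S5 (`stub_sectorFloorGC`), verbatim.** -/
theorem stub_sectorFloorGC_proved :
    ∀ (L : ℕ) [NeZero L] (R : ℕ) (U μ κ : ℝ) (N : ℕ),
      (∃ φ : Fock (Orb (FermionTorus 2 L)), φ ∈ szSector N 0 ∧ φ ≠ 0) →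
        (hubbardTorusWith 2 L 1 U μ + (κ : ℂ) • (((((R : ℝ) ^ 4)⁻¹ : ℝ) : ℂ) • ∑ a : Literature.Probability.LatticeModels.TorusSite 2 L, (∑ u : Fin 2 → Fin R, localPair dWaveFormFactor L (a + fun i => ((u i : ℕ) : ZMod L)))ᴴ * (∑ u : Fin 2 → Fin R, localPair dWaveFormFactor L (a + fun i => ((u i : ℕ) : ZMod L))))).groundEnergy ≤
          (hubbardTorus 2 L 1 U + (κ : ℂ) • (((((R : ℝ) ^ 4)⁻¹ : ℝ) : ℂ) • ∑ a : Literature.Probability.LatticeModels.TorusSite 2 L, (∑ u : Fin 2 → Fin R, localPair dWaveFormFactor L (a + fun i => ((u i : ℕ) : ZMod L)))ᴴ * (∑ u : Fin 2 → Fin R, localPair dWaveFormFactor L (a + fun i => ((u i : ℕ) : ZMod L))))).minEnergyOn (szSector N 0) - μ * (N : ℝ) := by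
  intro L _ R U μ κ N hne
  have hA := isHermitian_add_real_smul (isHermitian_hubbardTorusWith L 1 U μ) (isHermitian_kacBlockOp L R) κ
  rw [hubbardTorusWith_eq] at hA ⊢
  exact groundEnergy_le_minEnergyOn_sector_sub _ _ μ N 0 hA hne

/-! ## S4: source removal (Weyl in the operator norm) -/

section Weyl

variable {n : Type*} [Fintype n] [DecidableEq n] [Nonempty n]

/-- One-sided Weyl: `E₀(A + X) ≤ E₀(A) + ‖X‖` for Hermitian `A`, `X` (the tracial ground state of `A` is a trial
state for `A + X`, and `|Re ω_A(X)| ≤ ‖X‖`). [folklore] -/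
theorem groundEnergy_add_le_add_norm {A X : Matrix n n ℂ} (hA : A.IsHermitian) (hX : X.IsHermitian) :
    (A + X).groundEnergy ≤ A.groundEnergy + ‖X‖ := by
  have h1 := groundEnergy_le_groundStateFunctional_re hA (hA.add hX)
  rw [map_add, Complex.add_re, groundStateFunctional_hamiltonian hA, Complex.ofReal_re] at h1
  have h2 := (le_abs_self _).trans (abs_re_groundStateFunctional_le_norm hA X)
  linarith

/-- **Weyl's inequality** for the ground energy: `|E₀(A + X) - E₀(A)| ≤ ‖X‖`. [folklore] -/
theorem abs_groundEnergy_add_sub_le_norm {A X : Matrix n n ℂ} (hA : A.IsHermitian) (hX : X.IsHermitian) :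
    |(A + X).groundEnergy - A.groundEnergy| ≤ ‖X‖ := by
  have h1 := groundEnergy_add_le_add_norm hA hX
  have h2 := groundEnergy_add_le_add_norm (hA.add hX) hX.neg
  rw [add_neg_cancel_right, norm_neg] at h2
  rw [abs_le]
  constructor <;> linarith

end Weyl

/-- `Σ_{e ∈ {0, ±e₁, ±e₂}} |d(e)/√2| = 4/√2 ≤ 3`. [folklore] -/
theorem sum_abs_dWaveFormFactor_div_sqrt_two_le :
    ∑ e ∈ insert (0 : Literature.Probability.LatticeModels.Site 2) unitSteps, |dWaveFormFactor e / Real.sqrt 2| ≤ 3 := by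
  rw [Finset.sum_insert zero_not_mem_unitSteps, dWaveFormFactor_zero, zero_div, abs_zero, zero_add, sum_unitSteps,
    dWaveFormFactor_unitStep, dWaveFormFactor_unitStep, dWaveFormFactor_neg_unitStep, dWaveFormFactor_neg_unitStep]
  simp only [Fin.isValue, if_true, one_ne_zero, if_false]
  have hs : 0 < Real.sqrt 2 := Real.sqrt_pos.2 (by norm_num)
  have h1 : |(1 : ℝ) / Real.sqrt 2| = 1 / Real.sqrt 2 := abs_of_nonneg (by positivity)
  have h2 : |(-1 : ℝ) / Real.sqrt 2| = 1 / Real.sqrt 2 := by rw [neg_div, abs_neg, h1]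
  rw [h1, h2]
  have hsq := Real.sq_sqrt (show (0 : ℝ) ≤ 2 by norm_num)
  have hle : Real.sqrt 2 ≤ 3 / 2 := by nlinarith [Real.sqrt_nonneg 2]
  have : 1 / Real.sqrt 2 ≤ 3 / 4 := by
    rw [div_le_div_iff₀ hs (by norm_num : (0:ℝ) < 4)]
    nlinarith
  linarith

/-- `‖h (P + Pᴴ)‖ ≤ 12 |h| L²`. [folklore] -/
theorem norm_source_le (L : ℕ) [NeZero L] (h : ℝ) :
    ‖(h : ℂ) • (pairField dWaveFormFactor L + (pairField dWaveFormFactor L)ᴴ)‖ ≤ 12 * |h| * (L : ℝ) ^ 2 := by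
  have hP := norm_pairField_le dWaveFormFactor L
  have hS := sum_abs_dWaveFormFactor_div_sqrt_two_le
  have hL : (0 : ℝ) ≤ (L : ℝ) ^ 2 := by positivity
  rw [norm_smul, Complex.norm_real, Real.norm_eq_abs]
  have h2 : ‖pairField dWaveFormFactor L + (pairField dWaveFormFactor L)ᴴ‖ ≤ 12 * (L : ℝ) ^ 2 := by
    calc ‖pairField dWaveFormFactor L + (pairField dWaveFormFactor L)ᴴ‖
        ≤ ‖pairField dWaveFormFactor L‖ + ‖(pairField dWaveFormFactor L)ᴴ‖ := norm_add_le _ _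
      _ = 2 * ‖pairField dWaveFormFactor L‖ := by rw [l2_opNorm_conjTranspose]; ring
      _ ≤ 2 * ((2 * ∑ e ∈ insert (0 : Literature.Probability.LatticeModels.Site 2) unitSteps,
            |dWaveFormFactor e / Real.sqrt 2|) * (L : ℝ) ^ 2) := by linarith
      _ ≤ 2 * ((2 * 3) * (L : ℝ) ^ 2) := by gcongr
      _ = 12 * (L : ℝ) ^ 2 := by ring
  calc |h| * ‖pairField dWaveFormFactor L + (pairField dWaveFormFactor L)ᴴ‖ ≤ |h| * (12 * (L : ℝ) ^ 2) :=
        mul_le_mul_of_nonneg_left h2 (abs_nonneg h)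
    _ = 12 * |h| * (L : ℝ) ^ 2 := by ring

/-- **S4 (`stub_sourceRemoval`), verbatim.** -/
theorem stub_sourceRemoval_proved :
    ∀ (L : ℕ) [NeZero L] (R : ℕ) (U μ h κ : ℝ),
      |(dWaveSourceTorus L U μ h + (κ : ℂ) • (((((R : ℝ) ^ 4)⁻¹ : ℝ) : ℂ) • ∑ a : Literature.Probability.LatticeModels.TorusSite 2 L, (∑ u : Fin 2 → Fin R, localPair dWaveFormFactor L (a + fun i => ((u i : ℕ) : ZMod L)))ᴴ * (∑ u : Fin 2 → Fin R, localPair dWaveFormFactor L (a + fun i => ((u i : ℕ) : ZMod L))))).groundEnergy -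
          (hubbardTorusWith 2 L 1 U μ + (κ : ℂ) • (((((R : ℝ) ^ 4)⁻¹ : ℝ) : ℂ) • ∑ a : Literature.Probability.LatticeModels.TorusSite 2 L, (∑ u : Fin 2 → Fin R, localPair dWaveFormFactor L (a + fun i => ((u i : ℕ) : ZMod L)))ᴴ * (∑ u : Fin 2 → Fin R, localPair dWaveFormFactor L (a + fun i => ((u i : ℕ) : ZMod L))))).groundEnergy| ≤ 12 * |h| * (L : ℝ) ^ 2 := by
  intro L _ R U μ h κ
  set W := (((((R : ℝ) ^ 4)⁻¹ : ℝ) : ℂ) • ∑ a : Literature.Probability.LatticeModels.TorusSite 2 L, (∑ u : Fin 2 → Fin R, localPair dWaveFormFactor L (a + fun i => ((u i : ℕ) : ZMod L)))ᴴ * (∑ u : Fin 2 → Fin R, localPair dWaveFormFactor L (a + fun i => ((u i : ℕ) : ZMod L)))) with hW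
  have hWh : W.IsHermitian := isHermitian_kacBlockOp L R
  have hA := isHermitian_add_real_smul (isHermitian_hubbardTorusWith L 1 U μ) hWh κ
  have hXh : ((h : ℂ) • (pairField dWaveFormFactor L + (pairField dWaveFormFactor L)ᴴ)).IsHermitian :=
    Matrix.IsHermitian.smul (isHermitian_pairField_add_conjTranspose L)
      (by rw [isSelfAdjoint_iff, Complex.star_def, Complex.conj_ofReal])
  have e : dWaveSourceTorus L U μ h + (κ : ℂ) • W =
      (hubbardTorusWith 2 L 1 U μ + (κ : ℂ) • W) + -((h : ℂ) • (pairField dWaveFormFactor L + (pairField dWaveFormFactor L)ᴴ)) := by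
    simp only [dWaveSourceTorus]
    abel
  rw [e]
  refine (abs_groundEnergy_add_sub_le_norm hA hXh.neg).trans ?_
  rw [norm_neg]
  exact norm_source_le L h


/-! ## S1: the two-parameter Griffiths block slope at a repelled base point -/

section TracialState

variable {n : Type*} [Fintype n] [DecidableEq n]

/-- Monotonicity of the tracial ground state: `Y - X ≥ 0 ⇒ Re ω(X) ≤ Re ω(Y)`. [folklore] -/
theorem re_groundStateFunctional_mono' (A : Matrix n n ℂ) {X Y : Matrix n n ℂ} (h : (Y - X).PosSemidef) :
    (A.groundStateFunctional X).re ≤ (A.groundStateFunctional Y).re := by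
  have h0 := (Complex.nonneg_iff.mp (groundStateFunctional_nonneg_of_posSemidef A h)).1
  rw [map_sub, Complex.sub_re] at h0
  linarith

omit [DecidableEq n] in
/-- Quadratic forms of Hermitian matrices are real. [folklore] -/
theorem im_star_dotProduct_mulVec_self {M : Matrix n n ℂ} (hM : M.IsHermitian) (x : n → ℂ) :
    (star x ⬝ᵥ M *ᵥ x).im = 0 := by
  have h1 : star x ⬝ᵥ M *ᵥ x = star (star (M *ᵥ x) ⬝ᵥ x) := star_dotProduct x (M *ᵥ x)
  have h2 : star (M *ᵥ x) ⬝ᵥ x = star x ⬝ᵥ M *ᵥ x := by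
    rw [star_mulVec, ← dotProduct_mulVec, hM.eq]
  rw [h2] at h1
  rw [Complex.star_def] at h1
  exact Complex.conj_eq_iff_im.1 h1.symm

omit [DecidableEq n] in
/-- A Hermitian matrix whose quadratic form has non-negative real part is positive semidefinite. [folklore] -/
theorem posSemidef_of_re_nonneg {M : Matrix n n ℂ} (hM : M.IsHermitian) (h : ∀ x : n → ℂ, 0 ≤ (star x ⬝ᵥ M *ᵥ x).re) :
    M.PosSemidef := by
  refine Matrix.PosSemidef.of_dotProduct_mulVec_nonneg hM fun x => ?_
  rw [Complex.nonneg_iff]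
  exact ⟨h x, (im_star_dotProduct_mulVec_self hM x).symm⟩

/-- **Cauchy–Schwarz for the tracial ground state**: `(Re ω(P))² ≤ Re ω(Pᴴ P)` (positivity of `ω` on
`(P - ω(P))ᴴ (P - ω(P))`, `ω(1) = 1`, `ω(Pᴴ) = conj ω(P)`). [folklore] -/
theorem sq_re_groundStateFunctional_le {A : Matrix n n ℂ} (hA : A.IsHermitian) [Nonempty n] (P : Matrix n n ℂ) :
    (A.groundStateFunctional P).re ^ 2 ≤ (A.groundStateFunctional (Pᴴ * P)).re := by
  set c : ℂ := A.groundStateFunctional P with hc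
  have h0 := groundStateFunctional_nonneg A (P - c • (1 : Matrix n n ℂ))
  have e : A.groundStateFunctional ((P - c • (1 : Matrix n n ℂ))ᴴ * (P - c • (1 : Matrix n n ℂ))) =
      A.groundStateFunctional (Pᴴ * P) - c * star c := by
    simp only [conjTranspose_sub, conjTranspose_smul, conjTranspose_one, sub_mul, mul_sub, Matrix.mul_smul,
      Matrix.smul_mul, mul_one, one_mul, smul_smul, map_sub, map_smul, smul_eq_mul,
      groundStateFunctional_one hA, groundStateFunctional_conjTranspose, ← hc]
    ring
  rw [e] at h0
  have hre := (Complex.nonneg_iff.mp h0).1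
  rw [Complex.sub_re, Complex.star_def, Complex.mul_conj, Complex.ofReal_re, Complex.normSq_apply] at hre
  nlinarith [sq_nonneg c.im]

end TracialState

/-- **S1 (`stub_blockSlope`), verbatim.** -/
theorem stub_blockSlope_proved :
    ∀ (L : ℕ) [NeZero L] (R : ℕ), 0 < R → ∀ (U μ h κ t : ℝ), 0 ≤ t →
      (dWaveSourceTorus L U μ h + ((κ - t : ℝ) : ℂ) • (((((R : ℝ) ^ 4)⁻¹ : ℝ) : ℂ) • ∑ a : Literature.Probability.LatticeModels.TorusSite 2 L, (∑ u : Fin 2 → Fin R, localPair dWaveFormFactor L (a + fun i => ((u i : ℕ) : ZMod L)))ᴴ * (∑ u : Fin 2 → Fin R, localPair dWaveFormFactor L (a + fun i => ((u i : ℕ) : ZMod L))))).groundEnergy -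
          (dWaveSourceTorus L U μ h + (κ : ℂ) • (((((R : ℝ) ^ 4)⁻¹ : ℝ) : ℂ) • ∑ a : Literature.Probability.LatticeModels.TorusSite 2 L, (∑ u : Fin 2 → Fin R, localPair dWaveFormFactor L (a + fun i => ((u i : ℕ) : ZMod L)))ᴴ * (∑ u : Fin 2 → Fin R, localPair dWaveFormFactor L (a + fun i => ((u i : ℕ) : ZMod L))))).groundEnergy ≤
        -t * ((dWaveSourceTorus L U μ h + (κ : ℂ) • (((((R : ℝ) ^ 4)⁻¹ : ℝ) : ℂ) • ∑ a : Literature.Probability.LatticeModels.TorusSite 2 L, (∑ u : Fin 2 → Fin R, localPair dWaveFormFactor L (a + fun i => ((u i : ℕ) : ZMod L)))ᴴ * (∑ u : Fin 2 → Fin R, localPair dWaveFormFactor L (a + fun i => ((u i : ℕ) : ZMod L))))).groundStateFunctional (pairField dWaveFormFactor L)).re ^ 2 / (L : ℝ) ^ 2 := by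
  intro L _ R hR U μ h κ t ht
  set W := (((((R : ℝ) ^ 4)⁻¹ : ℝ) : ℂ) • ∑ a : Literature.Probability.LatticeModels.TorusSite 2 L, (∑ u : Fin 2 → Fin R, localPair dWaveFormFactor L (a + fun i => ((u i : ℕ) : ZMod L)))ᴴ * (∑ u : Fin 2 → Fin R, localPair dWaveFormFactor L (a + fun i => ((u i : ℕ) : ZMod L)))) with hW
  set T := dWaveSourceTorus L U μ h with hT
  set P := pairField dWaveFormFactor L with hP
  have hWh : W.IsHermitian := isHermitian_kacBlockOp L R
  have hTh : T.IsHermitian := dWaveSourceTorus_isHermitian L (isHermitian_hubbardTorusWith L 1 U μ) h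
  have hA : (T + (κ : ℂ) • W).IsHermitian := isHermitian_add_real_smul hTh hWh κ
  -- Step 1: the variational chord in the block direction at the repelled base point
  have hchord := sub_mul_re_groundStateFunctional_le hTh hWh (-κ) (-(κ - t))
  have e1 : T - ((-κ : ℝ) : ℂ) • W = T + (κ : ℂ) • W := by
    rw [Complex.ofReal_neg, neg_smul, sub_neg_eq_add]
  have e2 : T - ((-(κ - t) : ℝ) : ℂ) • W = T + ((κ - t : ℝ) : ℂ) • W := by
    rw [Complex.ofReal_neg, neg_smul, sub_neg_eq_add]
  have e3 : (-(κ - t) - -κ : ℝ) = t := by ring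
  rw [e1, e2, e3] at hchord
  -- Step 2a: block coherence dominates the pair intensity, `Re ω(PᴴP) ≤ L² Re ω(W)`
  have hL : (0 : ℝ) < (L : ℝ) ^ 2 := cast_sq_pos_of_neZero L
  have hpsd : (((((L : ℝ) ^ 2 : ℝ)) : ℂ) • W - Pᴴ * P).PosSemidef := by
    refine posSemidef_of_re_nonneg ?_ fun x => ?_
    · exact (Matrix.IsHermitian.smul hWh (by rw [isSelfAdjoint_iff, Complex.star_def, Complex.conj_ofReal])).sub
        (isHermitian_conjTranspose_mul_self P)
    · have hx := re_expect_pairIntensity_le_sq_mul_blockRepulsion L R hR x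
      rw [sub_mulVec, dotProduct_sub, Complex.sub_re, smul_mulVec, dotProduct_smul, smul_eq_mul,
        Complex.re_ofReal_mul]
      change (star x ⬝ᵥ (Pᴴ * P) *ᵥ x).re ≤ _ at hx
      linarith
  have h2a := re_groundStateFunctional_mono' (T + (κ : ℂ) • W) hpsd
  rw [map_smul, smul_eq_mul, Complex.re_ofReal_mul] at h2a
  -- Step 2b: Cauchy–Schwarz for the tracial state
  have h2b := sq_re_groundStateFunctional_le hA P
  -- combine
  have key : ((T + (κ : ℂ) • W).groundStateFunctional P).re ^ 2 / (L : ℝ) ^ 2 ≤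
      ((T + (κ : ℂ) • W).groundStateFunctional W).re := by
    rw [div_le_iff₀ hL]
    nlinarith
  have hmul := mul_le_mul_of_nonneg_left key ht
  have e4 : -t * ((T + (κ : ℂ) • W).groundStateFunctional P).re ^ 2 / (L : ℝ) ^ 2 =
      -(t * (((T + (κ : ℂ) • W).groundStateFunctional P).re ^ 2 / (L : ℝ) ^ 2)) := by ring
  rw [e4]
  linarith

end Summit.HubbardSuperconductivity.HubbardSuperconductivity.Cruxes.CwSsbToEvenTorusLRO.DrefuteStubProofs

end
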